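import Summits.QuantumFields.BalabanUV.T4Continuum.Support.VariationalColourTaxiTowerLeaves
import Summits.QuantumFields.BalabanUV.T4Continuum.Support.SliceFrameGap

/-!
# T⁴ programme, spine node NE2 (U1a), lane P2 — «COMP-FIBRE-MISMATCH»: THE IN-BLOCK MISMATCH CLASS OF THE TWO-STEP TAXI FRAMES (the `hw₂` ∕ `revPC d n w₂` input of
# `SliceFrameGap.sliceFrames_close` in STEP (ii) of the composite-fibre ↔ taxi-frame bridge; model level; cell `pub-balaban`)

NE2 formalisation swarm `b2b-balaban-t4-ne2-formalise-*`, leaf prover 03 GEN 7 (`prover-b2b-balaban-t4-ne2-formalise-leaf-03-g7-0`); register row «P2-sup» of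
`t4/formal/NE2/LEAVES.md`; journal OFFER ∕ INTENT «COMP-FIBRE-MISMATCH» CLAIMS.log l.21186 (supplier for STEP (ii) of leaf-04-g6's plan
`HOME/t4/b2b-balaban-t4-ne2-formalise-leaf-04/g6/NEXT-composite-fibre-bridge.md`; companion of `CompositeFibreRelabel`).  On top of gen 2∕4's taxi lemmas BY NAME:
`VariationalColourTaxiLines.{inBlock_defect_taxiTv_adjoint_le, hcross_taxiTv_le}`, `VariationalColourTaxiTowerLeaves.inBlock_blockOf_of_bpt`, `VariationalColourTower.compTv`,
`ScalarBlockTrialFunction.{bpt_add_unitVec_of_lt, bpt_add_unitVec_of_eq}`, `B5Composition116.{sites, bpt_bpt}`.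

THE OBJECT.  The TWO-STEP frames on the two-level torus `Tor (fine L (fine n M))`: a unitary frame field `T` of the level-`n` torus (fibre at `z` ↦ fibre at the unit-block base point)
composed with the one-step taxi `taxiTv L (fine n M) R′` — read on the composite torus this is `compTv n L M T (taxiTv L _ R′)`; at the END's data `T = taxiTv n M (Rlev k)`, `n = L^k`.
 * §1 **`mismatch_twoStep_bpt`**: for a bond `(x, x+e_μ)` of the fine torus INSIDE a unit block, `‖R′(x,μ) ∘ (T(z₁)·taxi′(x+e_μ))⋆ ∘ (T(z₀)·taxi′(x)) − 1‖ ≤ (d−1)(L−1)(2L−1)·b + w_T`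
   (`b` the plaquette bound of `R′`, `w_T` the in-block mismatch of `T` against the straight coarsening `coarseTv L _ R′`): case A (same `L`-sub-block, `z₁ = z₀`) the outer frame CANCELS by
   unitarity and `inBlock_defect_taxiTv_adjoint_le` bounds the one-step taxi mismatch; case B (the bond crosses a level-`n` face inside the unit block, `z₁ = z₀ + e_μ`) the identity
   `U T₁′⋆ X T₀′ − 1 = (U T₁′⋆ − T₀′⋆C)·X·T₀′ + T₀′⋆(C X − 1)T₀′` (`X = T(z₁)⋆T(z₀)`, `C = coarseTv R′ z₀ μ`; `noncomm_ring` after `T₀′⋆T₀′ = 1`) splits it into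
   `hcross_taxiTv_le` and the level-`n` mismatch of `T`;
 * §2 `blockOf_sites` (unit block of a composite-torus site = unit block of its level-`n` site) and **`mismatch_compTv_taxi`**: the same bound in the composite-torus letters that
   `SliceFrameGap.sliceFrames_close` consumes (`hw₂` shape: `blockOf (n·L) M (x + e_μ) = blockOf (n·L) M x → ‖Rtrv R′ x μ ∘ (compTv T taxi′ (x+e_μ))⋆ ∘ compTv T taxi′ x − 1‖ ≤ …`);
 * §4 (STEP (ii)(b)) **`sqrt_projG_le_of_frames`**: leaf-04-g6's `sliceFrames_close` read through `norm_starProjection_le_of_oneSided'` —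
   `√(projG R (ker Q_{T₁}) W) ≤ √(projG R (ker Q_{T₂}) W) + 4τ·revPC d n w₂·√(divSq R W)` (coefficient ONE; general unitary frames);
 * §3 **`mismatch_twoStepTaxi`**: `T := taxiTv n M (coarseTv L _ R′)` (the straight level-`n` taxi of the coarse bonds; = `taxiTv (Rlev k)` along a coherent tower), whose own mismatch is
   `(d−1)(n−1)·a` (`a` the plaquette bound of the coarse bonds; `inBlock_blockOf_of_bpt` + `inBlock_defect_taxiTv_adjoint_le`): total `(d−1)(L−1)(2L−1)·b + (d−1)(n−1)·a`;
   **`mismatch_twoStepTaxi_class`**: with `n = L^k`, `(L^k·L)²·b ≤ c`, `(L^k)²·a ≤ c`: `(L^k·L)·w ≤ 3(d−1)·L·c` — k-UNIFORM, so `revPC d (L^k·L) w ≤ 4d·36^d(1 + 3(d−1)Lc)²`.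

HONEST FRAMING (T4-DAG p. 1).  Model level (c5: operators ∕ frames DATA; no B0); [folklore] bookkeeping over the taxi lemmas, NO analytic content; no `def`, no `def … : Prop`, no `sorry`;
axioms standard.  STEP (ii)(b)(c) of the bridge and the one-step carrier move remain OPEN; (ONE-min) ∕ V-END with background ∕ NE2 NOT proved; NE3 OPEN; spine PROVED 0∕9 unchanged;
rung (B)+1 on a fixed finite T⁴ — NOT infinite volume, NOT mass gap, NOT Clay.  HONEST DEPENDENCY (cell, verbatim): continuum YM on T⁴ ⇐ BetaPertH ∧ nine spine estimates (0/9 proved);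
BetaPertH ⇐ (D1) ∧ (D4) ∧ CAP+tail; G-an2-4 gates asym, D1 and NE2/3/4.
-/

noncomputable section

namespace Summit.QuantumFields.BalabanUV.T4Continuum.CompositeFibreMismatch

open Finset
open scoped BigOperators
open Literature.MathematicalPhysics.QuantumFieldTheory.Balaban1983to89.B5Prop11Plancherel (Tor fine unitVec)
open Literature.MathematicalPhysics.QuantumFieldTheory.Balaban1983to89.B5Block118 (bpt)
open Literature.MathematicalPhysics.QuantumFieldTheory.Balaban1983to89.B5Blocks16 (blockOf blockOf_bpt bpt_bijective)
open Literature.MathematicalPhysics.QuantumFieldTheory.Balaban1983to89.B5Composition116 (sites J JEquiv JEquiv_apply bpt_bpt)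
open Summit.QuantumFields.BalabanUV.T4Continuum.ScalarBlockTrialFunction (bpt_add_unitVec_of_lt bpt_add_unitVec_of_eq)
open Summit.QuantumFields.BalabanUV.T4Continuum.VariationalColourFederbush (norm_le_one_of_mem_unitary)
open Summit.QuantumFields.BalabanUV.T4Continuum.VariationalColourTower (Rtrv compTv compTv_mem_unitary)
open Summit.QuantumFields.BalabanUV.T4Continuum.VariationalVectorWeitzenbock (divV divSq)
open Summit.QuantumFields.BalabanUV.T4Continuum.VariationalVectorGaugeSlice (avgOp sliceSub projG norm_toLp_sq)
open Summit.QuantumFields.BalabanUV.T4Continuum.CovariantBlockReversePoincare (revPC revPC_nonneg)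
open Summit.QuantumFields.BalabanUV.T4Continuum.SliceFrameGap (sliceFrames_close)
open Summit.QuantumFields.BalabanUV.T4Continuum.DivControlOfSliceClose (norm_starProjection_le_of_oneSided')
open WithLp
open Summit.QuantumFields.BalabanUV.T4Continuum.VariationalCovariantTower (sites_add)
open Summit.QuantumFields.BalabanUV.T4Continuum.VariationalTower (sites_unitVec)
open Summit.QuantumFields.BalabanUV.T4Continuum.VariationalColourTaxiTransport
  (taxiTv coarseTv Rlev taxiTv_mem_unitary coarseTv_mem_unitary coarseTv_eq_Rlev inBlock_defect_taxiTv_adjoint_le hcross_taxiTv_le inBlock_blockOf_of_bpt)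

variable {d : ℕ} {H : Type*} [NormedAddCommGroup H] [InnerProductSpace ℂ H] [CompleteSpace H]
variable (L n : ℕ) [NeZero L] [NeZero n] (M : Fin d → ℕ) [hM : ∀ μ, NeZero (M μ)]

/-! ## §1 The two-step frames on the two-level torus -/

/-- **THE IN-BLOCK MISMATCH OF THE TWO-STEP FRAMES** `x ↦ T (block_L x) ∘ taxiTv L _ R′ x` at a fine bond `(x, x + e_μ)`, `x = L·z + j`, INSIDE a unit block:
`‖R′(x,μ) ∘ (T(z₁) ∘ taxi′(x+e_μ))⋆ ∘ (T(z) ∘ taxi′(x)) − 1‖ ≤ (d−1)(L−1)(2L−1)·b + w_T` (`z₁` = the level-`n` site of `x + e_μ`; `b` = plaquette bound of `R′`; `w_T` = in-block mismatch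
of `T` against the straight coarsening `coarseTv L _ R′`). [folklore] -/
theorem mismatch_twoStep_bpt {R' : Tor (fine L (fine n M)) → Fin d → (H →L[ℂ] H)} (hU : ∀ x μ, R' x μ ∈ unitary (H →L[ℂ] H)) {b : ℝ}
    (hb : ∀ x κ ι, ‖R' x κ * R' (x + unitVec (fine L (fine n M)) κ) ι - R' x ι * R' (x + unitVec (fine L (fine n M)) ι) κ‖ ≤ b)
    {T : Tor (fine n M) → (H →L[ℂ] H)} (hT : ∀ z, T z ∈ unitary (H →L[ℂ] H)) {wT : ℝ} (hwT0 : 0 ≤ wT)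
    (hTw : ∀ (z : Tor (fine n M)) (μ : Fin d), blockOf n M (z + unitVec (fine n M) μ) = blockOf n M z →
      ‖coarseTv L (fine n M) R' z μ * star (T (z + unitVec (fine n M) μ)) * T z - 1‖ ≤ wT)
    (z : Tor (fine n M)) (j : Fin d → Fin L) (μ : Fin d)
    (hblk : blockOf n M (blockOf L (fine n M) (bpt L (fine n M) z j + unitVec (fine L (fine n M)) μ)) = blockOf n M z) :
    ‖R' (bpt L (fine n M) z j) μ
        * star (T (blockOf L (fine n M) (bpt L (fine n M) z j + unitVec (fine L (fine n M)) μ)) * taxiTv L (fine n M) R' (bpt L (fine n M) z j + unitVec (fine L (fine n M)) μ))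
        * (T z * taxiTv L (fine n M) R' (bpt L (fine n M) z j)) - 1‖
      ≤ ((d - 1 : ℕ) : ℝ) * ((L - 1 : ℕ) : ℝ) * ((2 * L - 1 : ℕ) : ℝ) * b + wT := by
  have hb0 : 0 ≤ b := (norm_nonneg _).trans (hb (bpt L (fine n M) z j) μ μ)
  set U := R' (bpt L (fine n M) z j) μ with hUdef
  set T₁' := taxiTv L (fine n M) R' (bpt L (fine n M) z j + unitVec (fine L (fine n M)) μ) with hT₁'
  set T₀' := taxiTv L (fine n M) R' (bpt L (fine n M) z j) with hT₀'
  have hUu : U ∈ unitary (H →L[ℂ] H) := hU _ _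
  have hT₁'u : T₁' ∈ unitary (H →L[ℂ] H) := taxiTv_mem_unitary L (fine n M) hU _
  have hT₀'u : T₀' ∈ unitary (H →L[ℂ] H) := taxiTv_mem_unitary L (fine n M) hU _
  have hbase : ((d - 1 : ℕ) : ℝ) * ((L - 1 : ℕ) : ℝ) * b ≤ ((d - 1 : ℕ) : ℝ) * ((L - 1 : ℕ) : ℝ) * ((2 * L - 1 : ℕ) : ℝ) * b := by
    have h1 : (1 : ℝ) ≤ ((2 * L - 1 : ℕ) : ℝ) := by
      have hL := Nat.pos_of_ne_zero (NeZero.ne L)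
      have : 1 ≤ 2 * L - 1 := by omega
      exact_mod_cast this
    have h0 : 0 ≤ ((d - 1 : ℕ) : ℝ) * ((L - 1 : ℕ) : ℝ) * b := by positivity
    nlinarith
  by_cases h : (j μ : ℕ) + 1 < L
  · -- case A: the bond stays in the `L`-sub-block; the outer frame cancels
    have hz : blockOf L (fine n M) (bpt L (fine n M) z j + unitVec (fine L (fine n M)) μ) = z := by
      rw [bpt_add_unitVec_of_lt L (fine n M) z j μ h, blockOf_bpt]
    rw [hz]
    have e : U * star (T z * T₁') * (T z * T₀') - 1 = U * star T₁' * T₀' - 1 := by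
      rw [star_mul]
      have h1 : star (T z) * T z = 1 := Unitary.star_mul_self_of_mem (hT z)
      calc U * (star T₁' * star (T z)) * (T z * T₀') - 1 = U * star T₁' * (star (T z) * T z) * T₀' - 1 := by simp only [mul_assoc]
        _ = U * star T₁' * T₀' - 1 := by rw [h1, mul_one]
    rw [e]
    exact (inBlock_defect_taxiTv_adjoint_le L (fine n M) hU hb z j μ h).trans (by linarith)
  · -- case B: the bond crosses a level-`n` face inside the unit block
    have hj : (j μ : ℕ) + 1 = L := by have := (j μ).is_lt; omega
    have hcarry : bpt L (fine n M) z j + unitVec (fine L (fine n M)) μ = bpt L (fine n M) (z + unitVec (fine n M) μ) (Function.update j μ 0) :=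
      bpt_add_unitVec_of_eq L (fine n M) z j μ hj
    have hz₁ : blockOf L (fine n M) (bpt L (fine n M) z j + unitVec (fine L (fine n M)) μ) = z + unitVec (fine n M) μ := by rw [hcarry, blockOf_bpt]
    rw [hz₁] at hblk ⊢
    set C := coarseTv L (fine n M) R' z μ with hC
    set X := star (T (z + unitVec (fine n M) μ)) * T z with hX
    have hCu : C ∈ unitary (H →L[ℂ] H) := coarseTv_mem_unitary L (fine n M) hU z μ
    have hM1 : ‖C * star (T (z + unitVec (fine n M) μ)) * T z - 1‖ ≤ wT := hTw z μ hblk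
    have hcross := hcross_taxiTv_le L (fine n M) hU hb z j μ hj
    -- the splitting identity
    have h0 : star T₀' * T₀' = 1 := Unitary.star_mul_self_of_mem hT₀'u
    have e : U * star (T (z + unitVec (fine n M) μ) * T₁') * (T z * T₀') - 1
        = (U * star T₁' - star T₀' * C) * (X * T₀') + star T₀' * (C * X - 1) * T₀' := by
      rw [star_mul]
      calc U * (star T₁' * star (T (z + unitVec (fine n M) μ))) * (T z * T₀') - 1
          = U * (star T₁' * star (T (z + unitVec (fine n M) μ))) * (T z * T₀') - star T₀' * T₀' := by rw [h0]
        _ = (U * star T₁' - star T₀' * C) * (X * T₀') + star T₀' * (C * X - 1) * T₀' := by rw [hX]; noncomm_ring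
    rw [e]
    have hXT : ‖X * T₀'‖ ≤ 1 := by
      have h1 : ‖star (T (z + unitVec (fine n M) μ))‖ ≤ 1 := norm_le_one_of_mem_unitary (Unitary.star_mem (hT _))
      have h2 : ‖T z‖ ≤ 1 := norm_le_one_of_mem_unitary (hT z)
      have h3 : ‖T₀'‖ ≤ 1 := norm_le_one_of_mem_unitary hT₀'u
      calc ‖X * T₀'‖ ≤ ‖X‖ * ‖T₀'‖ := norm_mul_le _ _
        _ ≤ (‖star (T (z + unitVec (fine n M) μ))‖ * ‖T z‖) * ‖T₀'‖ := mul_le_mul_of_nonneg_right (norm_mul_le _ _) (norm_nonneg _)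
        _ ≤ (1 * 1) * 1 := by gcongr
        _ = 1 := by norm_num
    have t1 : ‖(U * star T₁' - star T₀' * C) * (X * T₀')‖ ≤ ((d - 1 : ℕ) : ℝ) * ((L - 1 : ℕ) : ℝ) * ((2 * L - 1 : ℕ) : ℝ) * b := by
      calc _ ≤ ‖U * star T₁' - star T₀' * C‖ * ‖X * T₀'‖ := norm_mul_le _ _
        _ ≤ (((d - 1 : ℕ) : ℝ) * ((L - 1 : ℕ) : ℝ) * ((2 * L - 1 : ℕ) : ℝ) * b) * 1 := mul_le_mul hcross hXT (norm_nonneg _) (by positivity)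
        _ = _ := mul_one _
    have t2 : ‖star T₀' * (C * X - 1) * T₀'‖ ≤ wT := by
      rw [CStarRing.norm_mul_mem_unitary _ hT₀'u, CStarRing.norm_mem_unitary_mul _ (Unitary.star_mem hT₀'u), hX, ← mul_assoc]
      exact hM1
    exact (norm_add_le _ _).trans (add_le_add t1 t2)

/-! ## §2 The composite-torus letters -/

/-- the unit block of a composite-torus site is the unit block of its level-`n` site. [folklore] -/
theorem blockOf_sites (x : Tor (fine (n * L) M)) : blockOf n M (blockOf L (fine n M) (sites n L M x)) = blockOf (n * L) M x := by
  obtain ⟨⟨y, Jx⟩, rfl⟩ := (bpt_bijective (n * L) M).2 x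
  obtain ⟨⟨j₂, j₁⟩, rfl⟩ := (JEquiv n L).surjective Jx
  rw [JEquiv_apply, ← bpt_bpt, blockOf_bpt, blockOf_bpt, blockOf_bpt]

/-- **THE `hw₂` SHAPE ON THE COMPOSITE TORUS**: for the composite frames `compTv n L M T (taxiTv L _ R′)` and the bonds `Rtrv R′`,
`blockOf (n·L) M (x + e_μ) = blockOf (n·L) M x → ‖Rtrv R′ x μ ∘ (compTv T taxi′ (x + e_μ))⋆ ∘ compTv T taxi′ x − 1‖ ≤ (d−1)(L−1)(2L−1)·b + w_T`. [folklore] -/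
theorem mismatch_compTv_taxi {R' : Tor (fine L (fine n M)) → Fin d → (H →L[ℂ] H)} (hU : ∀ x μ, R' x μ ∈ unitary (H →L[ℂ] H)) {b : ℝ}
    (hb : ∀ x κ ι, ‖R' x κ * R' (x + unitVec (fine L (fine n M)) κ) ι - R' x ι * R' (x + unitVec (fine L (fine n M)) ι) κ‖ ≤ b)
    {T : Tor (fine n M) → (H →L[ℂ] H)} (hT : ∀ z, T z ∈ unitary (H →L[ℂ] H)) {wT : ℝ} (hwT0 : 0 ≤ wT)
    (hTw : ∀ (z : Tor (fine n M)) (μ : Fin d), blockOf n M (z + unitVec (fine n M) μ) = blockOf n M z →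
      ‖coarseTv L (fine n M) R' z μ * star (T (z + unitVec (fine n M) μ)) * T z - 1‖ ≤ wT)
    (x : Tor (fine (n * L) M)) (μ : Fin d) (hx : blockOf (n * L) M (x + unitVec (fine (n * L) M) μ) = blockOf (n * L) M x) :
    ‖Rtrv n L M R' x μ * star (compTv n L M T (taxiTv L (fine n M) R') (x + unitVec (fine (n * L) M) μ)) * compTv n L M T (taxiTv L (fine n M) R') x - 1‖
      ≤ ((d - 1 : ℕ) : ℝ) * ((L - 1 : ℕ) : ℝ) * ((2 * L - 1 : ℕ) : ℝ) * b + wT := by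
  have hblk' : blockOf n M (blockOf L (fine n M) (sites n L M x + unitVec (fine L (fine n M)) μ)) = blockOf n M (blockOf L (fine n M) (sites n L M x)) := by
    rw [← sites_unitVec n L M μ, ← sites_add, blockOf_sites, blockOf_sites, hx]
  obtain ⟨⟨y, Jx⟩, rfl⟩ := (bpt_bijective (n * L) M).2 x
  obtain ⟨⟨j₂, j₁⟩, rfl⟩ := (JEquiv n L).surjective Jx
  simp only [JEquiv_apply, ← bpt_bpt, blockOf_bpt] at hblk'
  simp only [Rtrv, compTv, sites_add, sites_unitVec, JEquiv_apply, ← bpt_bpt, blockOf_bpt]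
  exact mismatch_twoStep_bpt L n M hU hb hT hwT0 hTw (bpt n M y j₂) j₁ μ (by rw [blockOf_bpt]; exact hblk')

/-! ## §3 The END's instance: the outer frames are the straight level-`n` taxi of the coarse bonds -/

/-- **THE TWO-STEP TAXI's IN-BLOCK MISMATCH**: with `T := taxiTv n M (coarseTv L _ R′)` (plaquette bound `a` for the coarse bonds, `1 < M_μ`),
`blockOf (n·L) M (x + e_μ) = blockOf (n·L) M x → ‖Rtrv R′ x μ ∘ (T″(x+e_μ))⋆ ∘ T″ x − 1‖ ≤ (d−1)(L−1)(2L−1)·b + (d−1)(n−1)·a`. [folklore] -/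
theorem mismatch_twoStepTaxi (hM2 : ∀ μ, 1 < M μ) {R' : Tor (fine L (fine n M)) → Fin d → (H →L[ℂ] H)} (hU : ∀ x μ, R' x μ ∈ unitary (H →L[ℂ] H)) {b a : ℝ}
    (hb : ∀ x κ ι, ‖R' x κ * R' (x + unitVec (fine L (fine n M)) κ) ι - R' x ι * R' (x + unitVec (fine L (fine n M)) ι) κ‖ ≤ b) (ha0 : 0 ≤ a)
    (ha : ∀ z κ ι, ‖coarseTv L (fine n M) R' z κ * coarseTv L (fine n M) R' (z + unitVec (fine n M) κ) ι
      - coarseTv L (fine n M) R' z ι * coarseTv L (fine n M) R' (z + unitVec (fine n M) ι) κ‖ ≤ a)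
    (x : Tor (fine (n * L) M)) (μ : Fin d) (hx : blockOf (n * L) M (x + unitVec (fine (n * L) M) μ) = blockOf (n * L) M x) :
    ‖Rtrv n L M R' x μ
        * star (compTv n L M (taxiTv n M (coarseTv L (fine n M) R')) (taxiTv L (fine n M) R') (x + unitVec (fine (n * L) M) μ))
        * compTv n L M (taxiTv n M (coarseTv L (fine n M) R')) (taxiTv L (fine n M) R') x - 1‖
      ≤ ((d - 1 : ℕ) : ℝ) * ((L - 1 : ℕ) : ℝ) * ((2 * L - 1 : ℕ) : ℝ) * b + ((d - 1 : ℕ) : ℝ) * ((n - 1 : ℕ) : ℝ) * a := by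
  have hUc : ∀ z κ, coarseTv L (fine n M) R' z κ ∈ unitary (H →L[ℂ] H) := fun z κ => coarseTv_mem_unitary L (fine n M) hU z κ
  have hTw := fun z μ hz => inBlock_blockOf_of_bpt n M hM2
    (P := fun z μ => ‖coarseTv L (fine n M) R' z μ * star (taxiTv n M (coarseTv L (fine n M) R') (z + unitVec (fine n M) μ)) * taxiTv n M (coarseTv L (fine n M) R') z - 1‖
      ≤ ((d - 1 : ℕ) : ℝ) * ((n - 1 : ℕ) : ℝ) * a)
    (fun y j μ hj => inBlock_defect_taxiTv_adjoint_le n M hUc ha y j μ hj) z μ hz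
  exact mismatch_compTv_taxi L n M hU hb (taxiTv_mem_unitary n M hUc) (by positivity) hTw x μ hx

omit [NeZero L] in
/-- **THE CLASS READING** (`n = L^k`, `(L^k·L)²·b ≤ c`, `(L^k)²·a ≤ c`, `1 ≤ L`): `(L^k·L)·((d−1)(L−1)(2L−1)·b + (d−1)(L^k−1)·a) ≤ 3(d−1)·L·c` — the mismatch is `O(1∕n)` k-UNIFORMLY,
so `revPC d (L^k·L) w ≤ 4d·36^d·(1 + 3(d−1)Lc)²` at every level. [folklore] -/
theorem mismatch_twoStepTaxi_class (k : ℕ) (hL : 1 ≤ L) {b a c : ℝ} (hb0 : 0 ≤ b) (ha0 : 0 ≤ a)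
    (hbc : ((((L ^ k * L : ℕ)) : ℝ)) ^ 2 * b ≤ c) (hac : ((((L ^ k : ℕ)) : ℝ)) ^ 2 * a ≤ c) :
    (((L ^ k * L : ℕ)) : ℝ) * (((d - 1 : ℕ) : ℝ) * ((L - 1 : ℕ) : ℝ) * ((2 * L - 1 : ℕ) : ℝ) * b + ((d - 1 : ℕ) : ℝ) * ((L ^ k - 1 : ℕ) : ℝ) * a)
      ≤ 3 * ((d - 1 : ℕ) : ℝ) * L * c := by
  have hLr : (1 : ℝ) ≤ L := by exact_mod_cast hL
  have hLk : (1 : ℝ) ≤ ((L ^ k : ℕ) : ℝ) := by exact_mod_cast Nat.one_le_pow k L hL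
  have hN : (((L ^ k * L : ℕ)) : ℝ) = ((L ^ k : ℕ) : ℝ) * L := by push_cast; ring
  have hL1 : ((L - 1 : ℕ) : ℝ) ≤ L := by exact_mod_cast Nat.sub_le L 1
  have h2L1 : ((2 * L - 1 : ℕ) : ℝ) ≤ 2 * L := by exact_mod_cast Nat.sub_le (2 * L) 1
  have hLk1 : ((L ^ k - 1 : ℕ) : ℝ) ≤ ((L ^ k : ℕ) : ℝ) := by exact_mod_cast Nat.sub_le (L ^ k) 1
  have hd0 : (0 : ℝ) ≤ ((d - 1 : ℕ) : ℝ) := Nat.cast_nonneg _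
  have hc0 : 0 ≤ c := le_trans (by positivity) hac
  rw [hN] at hbc ⊢
  set N : ℝ := ((L ^ k : ℕ) : ℝ) with hNdef
  set D : ℝ := ((d - 1 : ℕ) : ℝ)
  -- first summand: `N·L·(L−1)(2L−1)·b ≤ N·L·2L²·b ≤ 2L·(N L)²·b ≤ 2L·c` (uses `1 ≤ N`)
  have hb1 : N * L * (((L - 1 : ℕ) : ℝ) * ((2 * L - 1 : ℕ) : ℝ) * b) ≤ 2 * L * c := by
    have h1 : ((L - 1 : ℕ) : ℝ) * ((2 * L - 1 : ℕ) : ℝ) ≤ L * (2 * L) :=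
      mul_le_mul hL1 h2L1 (Nat.cast_nonneg _) (by positivity)
    have h2 : N * L * (((L - 1 : ℕ) : ℝ) * ((2 * L - 1 : ℕ) : ℝ) * b) ≤ N * L * (L * (2 * L) * b) := by
      apply mul_le_mul_of_nonneg_left (mul_le_mul_of_nonneg_right h1 hb0) (by positivity)
    have h5 : N * ((L : ℝ) * L * b) ≤ (N * L) ^ 2 * b := by
      have : 0 ≤ (N - 1) * (N * (L * L * b)) := mul_nonneg (sub_nonneg.2 hLk) (by positivity)
      nlinarith [this]
    have h6 : N * L * (L * (2 * L) * b) = 2 * L * (N * ((L : ℝ) * L * b)) := by ring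
    have h7 : 2 * (L : ℝ) * (N * ((L : ℝ) * L * b)) ≤ 2 * L * c :=
      mul_le_mul_of_nonneg_left (h5.trans hbc) (by positivity)
    linarith
  -- second summand: `N·L·(N−1)·a ≤ L·(N² a) ≤ L·c`
  have ha1 : N * L * (((L ^ k - 1 : ℕ) : ℝ) * a) ≤ L * c := by
    calc N * L * (((L ^ k - 1 : ℕ) : ℝ) * a) ≤ N * L * (N * a) := by
          apply mul_le_mul_of_nonneg_left (mul_le_mul_of_nonneg_right hLk1 ha0) (by positivity)
      _ = L * (N ^ 2 * a) := by ring
      _ ≤ L * c := mul_le_mul_of_nonneg_left hac (by positivity)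
  calc N * L * (D * ((L - 1 : ℕ) : ℝ) * ((2 * L - 1 : ℕ) : ℝ) * b + D * ((L ^ k - 1 : ℕ) : ℝ) * a)
      = D * (N * L * (((L - 1 : ℕ) : ℝ) * ((2 * L - 1 : ℕ) : ℝ) * b)) + D * (N * L * (((L ^ k - 1 : ℕ) : ℝ) * a)) := by ring
    _ ≤ D * (2 * L * c) + D * (L * c) := add_le_add (mul_le_mul_of_nonneg_left hb1 hd0) (mul_le_mul_of_nonneg_left ha1 hd0)
    _ = 3 * D * L * c := by ring

/-! ## §4 STEP (ii)(b): the coefficient-ONE comparison of the two gauge fixings of Bałaban's projected functional -/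

/-- **THE STRAIGHT-TAXI FUNCTIONAL AGAINST THE TWO-STEP ONE, COEFFICIENT ONE** (general unitary frames): for unitary `R` on a torus, unitary frame fields `T₁` (in-block
mismatch `w₁`, `2d(n w₁)² ≤ ½`) and `T₂` (mismatch `w₂ ≥ 0`) with `‖T₁ − T₂‖ ≤ τ`:
`√(projG R (ker Q_{T₁}) W) ≤ √(projG R (ker Q_{T₂}) W) + (4τ·revPC d n w₂)·√(divSq R W)` — leaf-04-g6's `sliceFrames_close` read through `norm_starProjection_le_of_oneSided'`
(the square-root ∕ coefficient-one form the END's `hONEm` consumes; `projG_le_of_sliceClose`'s factor 2 is avoided). [folklore] -/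
theorem sqrt_projG_le_of_frames [FiniteDimensional ℂ H] {N : ℕ} [NeZero N] {R : Tor (fine N M) → Fin d → (H →L[ℂ] H)} (hU : ∀ x μ, R x μ ∈ unitary (H →L[ℂ] H))
    {T₁ T₂ : Tor (fine N M) → (H →L[ℂ] H)} (hT₁ : ∀ x, T₁ x ∈ unitary (H →L[ℂ] H)) (hT₂ : ∀ x, T₂ x ∈ unitary (H →L[ℂ] H))
    {τ : ℝ} (hτ : ∀ x, ‖T₁ x - T₂ x‖ ≤ τ) {w₁ w₂ : ℝ}
    (hw₁ : ∀ (x : Tor (fine N M)) (μ : Fin d), blockOf N M (x + unitVec (fine N M) μ) = blockOf N M x → ‖R x μ * star (T₁ (x + unitVec (fine N M) μ)) * T₁ x - 1‖ ≤ w₁)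
    (hsmall₁ : 2 * (d : ℝ) * ((N : ℝ) * w₁) ^ 2 ≤ 1 / 2) (hw₂0 : 0 ≤ w₂)
    (hw₂ : ∀ (x : Tor (fine N M)) (μ : Fin d), blockOf N M (x + unitVec (fine N M) μ) = blockOf N M x → ‖R x μ * star (T₂ (x + unitVec (fine N M) μ)) * T₂ x - 1‖ ≤ w₂)
    (W : Tor (fine N M) → Fin d → H) :
    Real.sqrt (projG (fine N M) R (LinearMap.ker (avgOp N M T₁)) W)
      ≤ Real.sqrt (projG (fine N M) R (LinearMap.ker (avgOp N M T₂)) W) + (4 * τ * revPC d N w₂) * Real.sqrt (divSq (fine N M) R W) := by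
  have hτ0 : 0 ≤ τ := (norm_nonneg _).trans (hτ 0)
  have hδ0 : 0 ≤ 4 * τ * revPC d N w₂ := by have := revPC_nonneg (d := d) N w₂; positivity
  have hclose := sliceFrames_close N M hU hT₁ hT₂ hτ hw₁ hsmall₁ hw₂0 hw₂
  set b : PiLp 2 (fun _ : Tor (fine N M) => H) := toLp 2 (divV (fine N M) R W) with hb
  have h := norm_starProjection_le_of_oneSided' _ _ hδ0 hclose b
  have e1 : Real.sqrt (projG (fine N M) R (LinearMap.ker (avgOp N M T₁)) W) = ‖(sliceSub (fine N M) R (LinearMap.ker (avgOp N M T₁))).starProjection b‖ := by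
    rw [show projG (fine N M) R (LinearMap.ker (avgOp N M T₁)) W = ‖(sliceSub (fine N M) R (LinearMap.ker (avgOp N M T₁))).starProjection b‖ ^ 2 from rfl,
      Real.sqrt_sq (norm_nonneg _)]
  have e2 : Real.sqrt (projG (fine N M) R (LinearMap.ker (avgOp N M T₂)) W) = ‖(sliceSub (fine N M) R (LinearMap.ker (avgOp N M T₂))).starProjection b‖ := by
    rw [show projG (fine N M) R (LinearMap.ker (avgOp N M T₂)) W = ‖(sliceSub (fine N M) R (LinearMap.ker (avgOp N M T₂))).starProjection b‖ ^ 2 from rfl,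
      Real.sqrt_sq (norm_nonneg _)]
  have e3 : Real.sqrt (divSq (fine N M) R W) = ‖b‖ := by
    have : divSq (fine N M) R W = ‖b‖ ^ 2 := by rw [hb, norm_toLp_sq]; rfl
    rw [this, Real.sqrt_sq (norm_nonneg _)]
  rw [e1, e2, e3]
  exact h

end Summit.QuantumFields.BalabanUV.T4Continuum.CompositeFibreMismatch

end
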